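import Literature.Probability.LatticeModels.ScalingLimit
import Mathlib.Topology.MetricSpace.Basic
import HarnessLib

/-!
# Continuity of pointwise scaling limits is NOT automatic

Topic `Probability/LatticeModels`; family `crit-ising`. A two-definition counterexample about the
prelude notion `HasPointwiseScalingLimit G ρ S` (`ScalingLimit.lean`): the lattice family
`signFamily` (reading the sign of the first coordinate of the first point) has, with `ρ ≡ 1`, the
EXACT pointwise scaling limit `signLimit` (the rescaled correlator equals the limit for every mesh,
because `0 ≤ ⌊t/δ⌋ ↔ 0 ≤ t`), and `signLimit 1` is discontinuous across the hyperplane `{x₀ = 0}`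
(`exists_discontinuous_pointwiseScalingLimit`). Two points straddling a coordinate hyperplane never
share a `δ`-cell of `latticeApprox`, so local uniformity on the open set of non-coincident
configurations says nothing across it.

Consequence for the conformal-limit problem on `ℤ³`: continuity of a limit `S` of `criticalCorr 3`
(used for translation / reflection invariance of limits and for boundary-layer arguments at the
diagonal) is a genuine LATTICE-REGULARITY input (`⟨…σ_{y+e}…⟩/⟨…σ_y…⟩ → 1` at scale `1/δ`), not a
consequence of the definition. [folklore]
-/

noncomputable section

open Filter Topology Set

namespace Literature.Probability.LatticeModels

/-- A lattice family reading the SIGN of the first coordinate of the first point: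
`1` if it is `≥ 0`, `2` otherwise (`0` for the empty configuration). [folklore] -/
def signFamily : LatticeCorrFamily 3 := fun n y =>
  if h : 0 < n then (if 0 ≤ y ⟨0, h⟩ 0 then 1 else 2) else 0

/-- Its exact pointwise scaling limit: the same step function on the continuum. [folklore] -/
def signLimit : CorrFamily 3 := fun n x =>
  if h : 0 < n then (if 0 ≤ x ⟨0, h⟩ 0 then 1 else 2) else 0

/-- `0 ≤ ⌊t/δ⌋ ↔ 0 ≤ t` for `δ > 0`. [folklore] -/
theorem floor_div_nonneg_iff {t δ : ℝ} (hδ : 0 < δ) : (0:ℤ) ≤ ⌊t / δ⌋ ↔ 0 ≤ t := by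
  rw [Int.floor_nonneg]
  constructor
  · intro h
    by_contra ht
    push Not at ht
    have : t / δ < 0 := div_neg_of_neg_of_pos ht hδ
    linarith
  · intro ht; positivity

/-- The rescaled correlator of `signFamily` (renormalisation `1`) IS `signLimit`, for every mesh. [folklore] -/
theorem rescaled_signFamily_eq {n : ℕ} {δ : ℝ} (hδ : 0 < δ) (x : Fin n → EuclideanSpace ℝ (Fin 3)) :
    rescaledCorrelator signFamily (fun _ => 1) n δ x = signLimit n x := by
  rw [rescaledCorrelator_apply, one_pow, one_mul]
  simp only [signFamily, signLimit, latticeApprox_apply]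
  by_cases hn : 0 < n
  · simp only [dif_pos hn]
    have key : ((0:ℤ) ≤ ⌊x ⟨0, hn⟩ 0 / δ⌋) ↔ 0 ≤ x ⟨0, hn⟩ 0 := floor_div_nonneg_iff hδ
    by_cases h0 : 0 ≤ x ⟨0, hn⟩ 0
    · rw [if_pos h0, if_pos (key.2 h0)]
    · rw [if_neg h0, if_neg (fun h => h0 (key.1 h))]
  · simp only [dif_neg hn]

/-- `signLimit` is the pointwise scaling limit of `signFamily`. [folklore] -/
theorem hasPointwiseScalingLimit_signFamily :
    HasPointwiseScalingLimit signFamily (fun _ => 1) signLimit := by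
  intro n
  refine TendstoUniformlyOn.tendstoLocallyUniformlyOn (Metric.tendstoUniformlyOn_iff.2 fun ε hε => ?_)
  filter_upwards [self_mem_nhdsWithin] with δ hδ x _
  rw [rescaled_signFamily_eq (Set.mem_Ioi.1 hδ), dist_self]
  exact hε

/-- The limit is NOT continuous on `NonCoincident 3 1` (= all one-point configurations): it jumps
across `{x₀₀ = 0}` (tested along the path `t ↦ t·e₀`). [folklore] -/
theorem not_continuousOn_signLimit : ¬ ContinuousOn (signLimit 1) (NonCoincident 3 1) := by
  intro hc
  set v₀ : EuclideanSpace ℝ (Fin 3) := EuclideanSpace.single (0 : Fin 3) (1:ℝ) with hv₀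
  set P : ℝ → (Fin 1 → EuclideanSpace ℝ (Fin 3)) := fun t _ => t • v₀ with hP
  have hPc : Continuous P := continuous_pi fun _ => continuous_id.smul continuous_const
  have hPmem : ∀ t, P t ∈ NonCoincident 3 1 := fun t => by
    rw [mem_nonCoincident]; intro i j _; exact Subsingleton.elim i j
  have hg : ∀ t, signLimit 1 (P t) = if 0 ≤ t then (1:ℝ) else 2 := by
    intro t
    simp [signLimit, hP, hv₀]
  -- continuity of the composite at `t = 0`
  have hcomp : ContinuousAt (fun t => signLimit 1 (P t)) 0 :=
    (hc.continuousAt ((isOpen_nonCoincident 3 1).mem_nhds (hPmem 0))).comp hPc.continuousAt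
  have hnhd : {t : ℝ | signLimit 1 (P t) ∈ Set.Ioo (1/2 : ℝ) (3/2)} ∈ 𝓝 (0:ℝ) := by
    refine hcomp.preimage_mem_nhds (Ioo_mem_nhds ?_ ?_) <;> rw [hg, if_pos le_rfl] <;> norm_num
  obtain ⟨ε, hε, hball⟩ := Metric.mem_nhds_iff.1 hnhd
  have hmem : (-(ε/2)) ∈ Metric.ball (0:ℝ) ε := by
    rw [Metric.mem_ball, Real.dist_eq, sub_zero, abs_neg, abs_of_pos (by positivity)]; linarith
  have h := hball hmem
  simp only [Set.mem_setOf_eq, hg, if_neg (show ¬ (0:ℝ) ≤ -(ε/2) by push Not; linarith)] at h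
  norm_num at h

/-- **Continuity of pointwise scaling limits is NOT automatic**: there is a lattice family with an (exact)
pointwise scaling limit that is discontinuous on the non-coincident configurations. [folklore] -/
theorem exists_discontinuous_pointwiseScalingLimit :
    ∃ (G : LatticeCorrFamily 3) (ρ : ℝ → ℝ) (S : CorrFamily 3), (∀ δ, 0 < ρ δ) ∧
      HasPointwiseScalingLimit G ρ S ∧ ¬ ContinuousOn (S 1) (NonCoincident 3 1) :=
  ⟨signFamily, fun _ => 1, signLimit, fun _ => one_pos, hasPointwiseScalingLimit_signFamily,
    not_continuousOn_signLimit⟩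

end Literature.Probability.LatticeModels

end
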